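import Summits.AnomalousDissipation.AnomalousDissipation.Theses.MirrorVariety
import Summits.AnomalousDissipation.AnomalousDissipation.Theorems.TaylorCertificatesSteadyClassicalBridgeDirect
import Summits.AnomalousDissipation.AnomalousDissipation.Theorems.WindLineWindyGalerkinSteadyZerothLawNormsOfH1Limit
import Literature.Analysis.FluidPDE.SteadyNavierStokesProofs
import Literature.Analysis.FluidPDE.SteadyNavierStokesRegularity
import Literature.Analysis.FluidPDE.SteadyNavierStokesEnergy
import Literature.Analysis.FluidPDE.SteadyNavierStokesWeakForm
import Literature.Analysis.FunctionSpaces.TorusFourierCalculus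

/-!
# `MirrorVariety.GalerkinSteadyZerothLaw` (stmt-AnomalousDissipation-2986) ⟸ `TaylorCertificates.SteadyStatesLoudBounded`
# (stmt-AnomalousDissipation-13038): the calm Galerkin steady zeroth law from "all calm steady states are loud" (cross-route edge)

Support file (pure proof file, no definitions).  Twin of `Theorems/WindLineWindyGalerkinSteadyZerothLawOfSteadyStatesLoudBounded.lean`
(13038 ⇒ WindLine's X, landed p161621) with the two extra clauses MirrorVariety's crux asks of the witnesses — MEAN ZERO and band-limited to
the PUNCTURED ball `(freqBall N).erase 0` — both of which the tree's stationary Galerkin states (`exists_steady_galerkin_approx`) have by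
construction.  Proof = Temam's Galerkin existence proof read backwards: the calm Galerkin states at a fixed `ν ∈ (0, ν₀)` lie in a compact
enstrophy ball of `H` (Rellich), a subsequence converges strongly in `L²` to a `V`-steady weak solution, which is smooth (Temam 1979 Ch. II
Prop. 1.1) and a classical calm steady state in the tested sense of 13038 (`steadyClassicalBridge_direct_proof`), hence loud and bounded;
the energy equation of the limit and strong `L²` convergence pass `(f, u_N) = ν‖∇u_N‖²` and `∫|u_N|²` back to the Galerkin states, which
are therefore eventually — so frequently in `N` — loud (`≥ ε₀/2`) and bounded (`≤ E + 1`).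

Main result: `galerkinSteadyZerothLaw_of_steadyStatesLoudBounded : SteadyStatesLoudBounded → GalerkinSteadyZerothLaw` (along
`ν_j = ν₀/(j+2)`).  With the landed `2986 → 11414` this is a second road 13038 → X; it is recorded for route MirrorVariety's own DAG.

References: Temam, *Navier–Stokes Equations* (1979) Ch. II §1 Thm. 1.2, Prop. 1.1; Constantin–Foias (1988) Ch. 8; Robinson–Rodrigo–
Sadowski (2016) Thm. 4.4.  Route files `Theses/MirrorVariety.lean`, `Theses/TaylorCertificates.lean`.
-/

noncomputable section

-- D-0017: single-problem summit ⇒ the duplicated namespace segment is by design.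
set_option linter.dupNamespace false

open MeasureTheory Filter Topology UnitAddTorus Set
open scoped InnerProductSpace RealInnerProductSpace ENNReal NNReal
open Literature.Analysis.FunctionSpaces Literature.Analysis.FunctionSpaces.Torus
open Literature.Analysis.FunctionSpaces.EuclideanSpace
open Literature.Analysis.FluidPDE Literature.Analysis.FluidPDE.Torus

namespace Summit.AnomalousDissipation.AnomalousDissipation.Theorems.MirrorVarietyGalerkinSteadyZerothLaw

/-- **Loud bounded CALM Galerkin states from `SteadyStatesLoudBounded`, at one viscosity** (calm twin of
`WindLineWindyGalerkinSteadyZerothLaw.frequently_loud_galerkin_of_allSteadyLoud`; the tree's stationary Galerkin states are MEAN ZERO and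
band-limited to the PUNCTURED ball, which is what `MirrorVariety.GalerkinSteadyZerothLaw` asks): if every smooth calm steady state of
`NS_ν(f)` (tested sense of 13038) has `ε₀ ≤ ν‖∇u‖²` and `∫|u|² ≤ E`, then frequently in `N` there is a smooth divergence-free mean-zero field
band-limited to `(freqBall N).erase 0` solving the tested Galerkin equations with `∫|u|² ≤ E + 1` and `ε₀/2 ≤ ν‖∇u‖²`.  Proof in the module
docstring. -/
theorem frequently_loud_calm_galerkin_of_allSteadyLoud {ν ε₀ E : ℝ} (hν : 0 < ν) (hε₀ : 0 < ε₀) {f : UnitAddTorus (Fin 3) → EuclideanSpace ℝ (Fin 3)} (hfs : IsSmooth f)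
    (hall : ∀ u : UnitAddTorus (Fin 3) → EuclideanSpace ℝ (Fin 3), IsSmooth u → IsDivFree u → HasZeroMean u →
      (∀ w : UnitAddTorus (Fin 3) → EuclideanSpace ℝ (Fin 3), IsSmooth w → IsDivFree w → HasZeroMean w →
        ∫ x, inner ℝ (ν • laplacian u x - convect u u x + f x) (w x) = 0) →
      ε₀ ≤ ν * gradNormSq u ∧ ∫ x, ‖u x‖ ^ 2 ≤ E) :
    ∃ᶠ N in atTop, ∃ u : UnitAddTorus (Fin 3) → EuclideanSpace ℝ (Fin 3), (IsSmooth u ∧ IsDivFree u ∧ HasZeroMean u ∧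
      (∀ k ∉ (freqBall N).erase (0 : Fin 3 → ℤ), mFourierCoeff (complexify ∘ u) k = 0) ∧
      ∀ a : UnitAddTorus (Fin 3) → EuclideanSpace ℝ (Fin 3), IsSmooth a → IsDivFree a →
        (∀ k ∉ (freqBall N).erase (0 : Fin 3 → ℤ), mFourierCoeff (complexify ∘ a) k = 0) →
        ∫ x, (inner ℝ (u x) (convect u a x) + ν * inner ℝ (u x) (laplacian a x) + inner ℝ (f x) (a x)) = 0) ∧
      ∫ x, ‖u x‖ ^ 2 ≤ E + 1 ∧ ε₀ / 2 ≤ ν * gradNormSq u := by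
  classical
  have hf2 : MemLp f 2 volume := hfs.memLp 2
  -- §1 the calm Galerkin steady states of the tree, with support, bounds, energy equation and tested equations
  choose C hCsymm hCtr hCsupp hCbd hCen hCtest using fun N : ℕ => exists_steady_galerkin_approx (d := Fin 3) hν hf2 N
  set U : ℕ → UnitAddTorus (Fin 3) → EuclideanSpace ℝ (Fin 3) := fun N => realTrigPoly ((freqBall (d := Fin 3) N).erase 0) (C N) with hUdef
  have hS : ∀ N : ℕ, ∀ k ∈ (freqBall (d := Fin 3) N).erase 0, -k ∈ (freqBall (d := Fin 3) N).erase 0 :=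
    fun N => neg_mem_freqBall_erase_zero
  have hUs : ∀ N, IsSmooth (U N) := fun N => isSmooth_realTrigPoly _ _
  have hUdiv : ∀ N, IsDivFree (U N) := fun N => isDivFree_realTrigPoly fun k _ => hCtr N k
  have hUmean : ∀ N, HasZeroMean (U N) := fun N => hasZeroMean_realTrigPoly_of_zero_not_mem (by simp) (C N)
  have hbds := fun N => steady_galerkin_bounds (N := N) hν (hCsymm N) (hCsupp N) (hCbd N)
  set Λ : ℝ := (∫ x, ‖f x‖ ^ 2) / (4 * Real.pi ^ 2 * ν) ^ 2 with hΛ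
  have hUgrad : ∀ N, eGradNormSq (U N) ≤ ENNReal.ofReal (4 * Real.pi ^ 2 * Λ) := fun N => (hbds N).1
  have hUL2r : ∀ N, ∫ x, ‖U N x‖ ^ 2 ≤ Λ := fun N => (hbds N).2.1
  have hUm : ∀ N, MemLp (U N) 2 volume := fun N => (hUs N).memLp 2
  have hUL2 : ∀ N, ∫⁻ x, ‖U N x‖ₑ ^ 2 ≤ ENNReal.ofReal Λ := fun N => by
    rw [Torus.lintegral_enorm_sq_eq_ofReal (hUm N)]
    exact ENNReal.ofReal_le_ofReal (hUL2r N)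
  have hUband : ∀ N, ∀ k ∉ (freqBall (d := Fin 3) N).erase 0, mFourierCoeff (complexify ∘ U N) k = 0 := fun N k hk => by
    have h := mFourierCoeff_realTrigPoly_of_support (hS N) (hCsymm N) (hCsupp N) k
    rw [h]
    exact hCsupp N k hk
  have hUen : ∀ N, ν * (eGradNormSq (U N)).toReal = ∫ x, ⟪f x, U N x⟫_ℝ := hCen
  have hUtest : ∀ N (a : UnitAddTorus (Fin 3) → EuclideanSpace ℝ (Fin 3)), IsSmooth a → IsDivFree a →
      (∀ k ∉ (freqBall (d := Fin 3) N).erase 0, mFourierCoeff (complexify ∘ a) k = 0) →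
      ∫ x, (⟪U N x, convect (U N) a x⟫_ℝ + ν * ⟪U N x, laplacian a x⟫_ℝ + ⟪f x, a x⟫_ℝ) = 0 := hCtest
  -- §2 compactness in `H` (Rellich) and the limit `u ∈ V`
  have hmem : ∀ N, (hUm N).toLp (U N) ∈ energySpace (Fin 3) := fun N =>
    smoothSolenoidal_subset_energySpace ⟨U N, hUs N, hUdiv N, hUmean N, (hUm N).coeFn_toLp⟩
  set v : ℕ → energySpace (Fin 3) := fun N => ⟨(hUm N).toLp (U N), hmem N⟩ with hv
  have hvae : ∀ N, ((v N).1 : UnitAddTorus (Fin 3) → EuclideanSpace ℝ (Fin 3)) =ᵐ[volume] U N := fun N => (hUm N).coeFn_toLp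
  set R : ℝ≥0∞ := ENNReal.ofReal (4 * Real.pi ^ 2 * Λ) with hR
  set K : Set (energySpace (Fin 3)) := {u | eGradNormSq (u.1 : UnitAddTorus (Fin 3) → EuclideanSpace ℝ (Fin 3)) ≤ R} with hK
  have hKc : IsCompact K := isCompact_setOf_eGradNormSq_le ENNReal.ofReal_ne_top
  have hvK : ∀ N, v N ∈ K := fun N => by
    show eGradNormSq ((v N).1 : UnitAddTorus (Fin 3) → EuclideanSpace ℝ (Fin 3)) ≤ R
    rw [eGradNormSq_congr_ae_field (hvae N)]
    exact hUgrad N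
  obtain ⟨u, huK, φ, hφ, hlim⟩ := hKc.tendsto_subseq hvK
  have huL2 : MemLp (u.1 : UnitAddTorus (Fin 3) → EuclideanSpace ℝ (Fin 3)) 2 volume := Lp.memLp _
  have huG : eGradNormSq (u.1 : UnitAddTorus (Fin 3) → EuclideanSpace ℝ (Fin 3)) ≤ R := huK
  have hV : u.1 ∈ energySpaceV (Fin 3) :=
    ⟨u.2, memSobolev_one_complexify_of_eGradNormSq_ne_top huL2 (ne_top_of_le_ne_top ENNReal.ofReal_ne_top huG)⟩
  -- strong convergence in `L²` along the subsequence
  have hconv : Tendsto (fun j => ∫⁻ x, ‖U (φ j) x - (u.1 : UnitAddTorus (Fin 3) → EuclideanSpace ℝ (Fin 3)) x‖ₑ ^ 2) atTop (𝓝 0) := by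
    have h1 : Tendsto (fun j => (v (φ j)).1) atTop (𝓝 u.1) := (continuous_subtype_val.tendsto u).comp hlim
    have h2 := tendsto_iff_norm_sub_tendsto_zero.1 h1
    have h3 : Tendsto (fun j => ‖(v (φ j)).1 - u.1‖ₑ ^ 2) atTop (𝓝 0) := by
      have h4 := ENNReal.tendsto_ofReal h2
      rw [ENNReal.ofReal_zero] at h4
      have h5 := ((ENNReal.continuous_pow 2).tendsto 0).comp h4
      rw [zero_pow two_ne_zero] at h5
      refine h5.congr fun j => ?_
      simp only [Function.comp_apply, ofReal_norm]
    refine h3.congr fun j => ?_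
    rw [← lintegral_enorm_coe_sub_coe_sq]
    refine lintegral_congr_ae ?_
    filter_upwards [hvae (φ j)] with x hx
    rw [hx]
  -- §3 the limit is a steady weak solution (Temam's step (iii))
  have hsol : IsSteadyWeakSolution ν f u := by
    intro w hw hwdiv hwmean
    have htrunc : ∀ M : ℕ, ∫ x, (⟪(u.1 : UnitAddTorus (Fin 3) → EuclideanSpace ℝ (Fin 3)) x, convect (u.1 : UnitAddTorus (Fin 3) → EuclideanSpace ℝ (Fin 3)) (fourierTruncate M w) x⟫_ℝ +
        ν * ⟪(u.1 : UnitAddTorus (Fin 3) → EuclideanSpace ℝ (Fin 3)) x, laplacian (fourierTruncate M w) x⟫_ℝ + ⟪f x, fourierTruncate M w x⟫_ℝ) = 0 := by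
      intro M
      have ha : IsSmooth (fourierTruncate M w) := isSmooth_fourierTruncate M w
      have hadiv : IsDivFree (fourierTruncate M w) :=
        isDivFree_realTrigPoly (hwdiv.isTransversal_mFourierCoeff hw (freqBall M))
      have hw0 : mFourierCoeff (complexify ∘ w) 0 = 0 := by
        rw [mFourierCoeff_eq_integral_volume]
        simp only [neg_zero, mFourier_zero, ContinuousMap.one_apply, one_smul, Function.comp_apply]
        rw [complexify.integral_comp_comm w, hwmean, map_zero]
      have hband : ∀ N, M ≤ N → ∀ k ∉ (freqBall (d := Fin 3) N).erase 0,
          mFourierCoeff (complexify ∘ fourierTruncate M w) k = 0 := by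
        intro N hMN k hk
        rw [mFourierCoeff_fourierTruncate hw.integrable]
        by_cases hkM : k ∈ freqBall M
        · have hk0 : k = 0 := by
            by_contra h
            exact hk (Finset.mem_erase.2 ⟨h, freqBall_mono hMN hkM⟩)
          subst hk0
          rw [if_pos hkM, hw0]
        · rw [if_neg hkM]
      have hev : ∀ᶠ j in atTop,
          ∫ x, (⟪U (φ j) x, convect (U (φ j)) (fourierTruncate M w) x⟫_ℝ +
            ν * ⟪U (φ j) x, laplacian (fourierTruncate M w) x⟫_ℝ + ⟪f x, fourierTruncate M w x⟫_ℝ) = 0 := by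
        filter_upwards [eventually_ge_atTop M] with j hj
        exact hUtest (φ j) _ ha hadiv (hband (φ j) (hj.trans (hφ.id_le j)))
      have hl := tendsto_integral_weakForm_of_tendsto_lintegral (ν := ν) hf2 (fun n => hUm (φ n))
        huL2 ENNReal.ofReal_ne_top (fun n => hUL2 (φ n)) hconv ha
      exact tendsto_nhds_unique hl (tendsto_const_nhds.congr' (hev.mono fun j hj => hj.symm))
    have hl2 := tendsto_integral_weakForm_fourierTruncate ν hf2 huL2 hw
    have hzero : ∫ x, (⟪(u.1 : UnitAddTorus (Fin 3) → EuclideanSpace ℝ (Fin 3)) x, convect (u.1 : UnitAddTorus (Fin 3) → EuclideanSpace ℝ (Fin 3)) w x⟫_ℝ +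
        ν * ⟪(u.1 : UnitAddTorus (Fin 3) → EuclideanSpace ℝ (Fin 3)) x, laplacian w x⟫_ℝ + ⟪f x, w x⟫_ℝ) = 0 :=
      tendsto_nhds_unique hl2 (tendsto_const_nhds.congr fun M => (htrunc M).symm)
    have hfinal : nsGeneratorPairing ν f u w =
        ∫ x, (⟪(u.1 : UnitAddTorus (Fin 3) → EuclideanSpace ℝ (Fin 3)) x, convect (u.1 : UnitAddTorus (Fin 3) → EuclideanSpace ℝ (Fin 3)) w x⟫_ℝ +
          ν * ⟪(u.1 : UnitAddTorus (Fin 3) → EuclideanSpace ℝ (Fin 3)) x, laplacian w x⟫_ℝ + ⟪f x, w x⟫_ℝ) := by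
      rw [integral_weakForm_eq ν hf2 huL2 hw]
      rfl
    rw [hfinal]
    exact hzero
  -- §4 regularity, the steady/classical bridge, and the hypothesis of 13038
  obtain ⟨w, hw, huw⟩ := Temam1979_steadyWeakSolution_smooth_holds (d := Fin 3) (by simp) hν hfs hV hsol
  obtain ⟨hwd, hwz, hwsteady⟩ := Theorems.steadyClassicalBridge_direct_proof _ f w u hfs hsol hw huw
  obtain ⟨hloud, hbdd⟩ := hall w hw hwd hwz hwsteady
  -- §5 energy equation of the limit: `(f, u) = ν‖∇w‖² ≥ ε₀`
  have hEq := Temam1979_steadyWeakSolution_energy_eq_holds (d := Fin 3) (by simp) hf2 hV hsol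
  have hpair : ∫ x, ⟪f x, (u.1 : UnitAddTorus (Fin 3) → EuclideanSpace ℝ (Fin 3)) x⟫_ℝ = ν * gradNormSq w := by
    rw [gradNormSq_eq_toReal_eGradNormSq_holds hw, ← eGradNormSq_congr_ae_field huw, hEq]
    unfold pairing
    exact integral_congr_ae (ae_of_all _ fun x => real_inner_comm _ _)
  -- §6 pass loudness and energy back to the Galerkin states
  have hP : Tendsto (fun j => ∫ x, ⟪f x, U (φ j) x⟫_ℝ) atTop (𝓝 (∫ x, ⟪f x, (u.1 : UnitAddTorus (Fin 3) → EuclideanSpace ℝ (Fin 3)) x⟫_ℝ)) :=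
    tendsto_integral_inner_of_tendsto_lintegral_sub_sq (fun j => hUm (φ j)) huL2 hf2 hconv
  have hEn : Tendsto (fun j => ∫ x, ‖U (φ j) x‖ ^ 2) atTop (𝓝 (∫ x, ‖w x‖ ^ 2)) := by
    refine Summit.AnomalousDissipation.AnomalousDissipation.Theorems.WindLineWindyGalerkinSteadyZerothLaw.tendsto_integral_norm_sq hw (fun j => hUs (φ j)) ?_
    have hsub : ∀ j, MemLp (fun x => U (φ j) x - w x) 2 volume := fun j => ((hUs (φ j)).sub hw).memLp 2
    have hconv' : Tendsto (fun j => ∫⁻ x, ‖U (φ j) x - w x‖ₑ ^ 2) atTop (𝓝 0) := by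
      refine hconv.congr fun j => lintegral_congr_ae ?_
      filter_upwards [huw] with x hx
      rw [hx]
    have h1 : Tendsto (fun j => (∫⁻ x, ‖U (φ j) x - w x‖ₑ ^ 2).toReal) atTop (𝓝 (0 : ℝ≥0∞).toReal) :=
      (ENNReal.tendsto_toReal ENNReal.zero_ne_top).comp hconv'
    rw [ENNReal.toReal_zero] at h1
    refine h1.congr fun j => ?_
    rw [Torus.lintegral_enorm_sq_eq_ofReal (hsub j), ENNReal.toReal_ofReal (integral_nonneg fun x => by positivity)]
  have hev1 : ∀ᶠ j in atTop, ∫ x, ‖U (φ j) x‖ ^ 2 ≤ E + 1 := by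
    have h : ∫ x, ‖w x‖ ^ 2 < E + 1 := by linarith
    filter_upwards [hEn.eventually_lt_const h] with j hj
    exact hj.le
  have hev2 : ∀ᶠ j in atTop, ε₀ / 2 ≤ ν * gradNormSq (U (φ j)) := by
    have h : ε₀ / 2 < ∫ x, ⟪f x, (u.1 : UnitAddTorus (Fin 3) → EuclideanSpace ℝ (Fin 3)) x⟫_ℝ := by
      rw [hpair]
      linarith
    filter_upwards [hP.eventually_const_lt h] with j hj
    rw [gradNormSq_eq_toReal_eGradNormSq_holds (hUs (φ j)), hUen (φ j)]
    exact hj.le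
  -- §7 frequently in `N`
  have hev : ∀ᶠ j in atTop, ∃ uu : UnitAddTorus (Fin 3) → EuclideanSpace ℝ (Fin 3), (IsSmooth uu ∧ IsDivFree uu ∧ HasZeroMean uu ∧
      (∀ k ∉ (freqBall (φ j)).erase (0 : Fin 3 → ℤ), mFourierCoeff (complexify ∘ uu) k = 0) ∧
      ∀ a : UnitAddTorus (Fin 3) → EuclideanSpace ℝ (Fin 3), IsSmooth a → IsDivFree a →
        (∀ k ∉ (freqBall (φ j)).erase (0 : Fin 3 → ℤ), mFourierCoeff (complexify ∘ a) k = 0) →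
        ∫ x, (inner ℝ (uu x) (convect uu a x) + ν * inner ℝ (uu x) (laplacian a x) + inner ℝ (f x) (a x)) = 0) ∧
      ∫ x, ‖uu x‖ ^ 2 ≤ E + 1 ∧ ε₀ / 2 ≤ ν * gradNormSq uu := by
    filter_upwards [hev1, hev2] with j hj1 hj2
    exact ⟨U (φ j), ⟨hUs (φ j), hUdiv (φ j), hUmean (φ j), hUband (φ j), fun a ha hdiv hband => hUtest (φ j) a ha hdiv hband⟩,
      hj1, hj2⟩
  exact hφ.tendsto_atTop.frequently hev.frequently


/-- **`SteadyStatesLoudBounded` (stmt-AnomalousDissipation-13038) ⇒ `MirrorVariety.GalerkinSteadyZerothLaw` (stmt-AnomalousDissipation-2986)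
BY NAME** — the CALM Galerkin steady zeroth law, a cross-route edge TaylorCertificates → MirrorVariety (and, through the landed 2986 → 11414, again WindLine's X), through `frequently_loud_calm_galerkin_of_allSteadyLoud` along `ν_j = ν₀/(j+2)` with budgets `E + 1`, `ε₀/2`. -/
theorem galerkinSteadyZerothLaw_of_steadyStatesLoudBounded :
    Summit.AnomalousDissipation.AnomalousDissipation.Theses.TaylorCertificates.SteadyStatesLoudBounded →
      Summit.AnomalousDissipation.AnomalousDissipation.Theses.MirrorVariety.GalerkinSteadyZerothLaw := by
  rintro ⟨f, hfs, hfd, hfz, ε₀, E, ν₀, hε₀, hν₀, hall⟩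
  refine ⟨f, hfs, hfd, hfz, fun j => ν₀ / ((j : ℝ) + 2), E + 1, ε₀ / 2, fun j => div_pos hν₀ (by positivity), ?_,
    by positivity, fun j => ?_⟩
  · have h1 : Tendsto (fun j : ℕ => ((j : ℝ) + 2)⁻¹) atTop (𝓝 0) :=
      tendsto_inv_atTop_zero.comp (tendsto_atTop_add_const_right atTop (2 : ℝ) tendsto_natCast_atTop_atTop)
    have h2 : Tendsto (fun j : ℕ => ν₀ * ((j : ℝ) + 2)⁻¹) atTop (𝓝 (ν₀ * 0)) := h1.const_mul ν₀
    rw [mul_zero] at h2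
    simpa [div_eq_mul_inv] using h2
  · have hj : (0 : ℝ) < (j : ℝ) + 2 := by positivity
    have hν : 0 < ν₀ / ((j : ℝ) + 2) := div_pos hν₀ hj
    have hνlt : ν₀ / ((j : ℝ) + 2) < ν₀ := by
      rw [div_lt_iff₀ hj]
      nlinarith
    exact frequently_loud_calm_galerkin_of_allSteadyLoud hν hε₀ hfs (hall _ hν hνlt)

end Summit.AnomalousDissipation.AnomalousDissipation.Theorems.MirrorVarietyGalerkinSteadyZerothLaw

end
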